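import Literature.Computability.Complexity.SkeletonTableau
import HarnessLib

/-!
# The quasi-linear tableau of a flat stack program, II: soundness

Literature / circuit complexity (serves `williams_acc` through the leaf
`Williams2014_fact_3_1_skeleton`; see `SkeletonTableau.lean` for the construction and the
references). This file proves the SOUNDNESS of the local constraints `TabOK`: from any
assignment satisfying them one extracts a witness `y` (the present witness slots, `|y| ≤ Y`)
such that the program, started at address `0` with `⟨x, y⟩` on its input register, is after
`T` steps at the halting address with `true` on top of its output register
(`Tableau.tabOK_sound`). The steps: the guessed height bits obey the local height rules
(`heightsOK_of_tabOK`, carry chains); the networks transport the time-`0` records bijectively to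
the output layer (`rec_transport`, `exists_posBack_eq`); the comparison and adjacency chains
there make a sorted certificate (`cert_of_tabOK`), whence every register transcript is
consistent (`StackEventConsistency.lean`); the one-hot program counters with the transition
constraints form a control-consistent transcript whose register events are the recorded ones,
so the replayed stacks are the genuine run (`FlatRunTranscripts.lean`); the virtual input
phase loads exactly `boolPair x y`, and the final check reads `true`.
-/

namespace Literature.Computability.Complexity

namespace Tableau

open StackEvents FlatRun Benes

variable {tb : TabParams} {τ : TabVar tb.K → Bool}

/-! ### Decoded quantities -/

section Decode

variable (tb) (τ)

/-- The high type bit of the time-`s` record of register `κ`. [folklore] -/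
def T1 (κ : Fin tb.K) (s : ℕ) : Bool := R tb τ κ 0 s fT1
/-- The low type bit of the time-`s` record of register `κ`. [folklore] -/
def T0 (κ : Fin tb.K) (s : ℕ) : Bool := R tb τ κ 0 s fT0
/-- The symbol bit of the time-`s` record of register `κ`. [folklore] -/
def Sy (κ : Fin tb.K) (s : ℕ) : Bool := R tb τ κ 0 s fSym

/-- The event of register `κ` at time `s` recorded by `τ`. [folklore] -/
def evOf (κ : Fin tb.K) (s : ℕ) : Ev :=
  match T1 tb τ κ s, T0 tb τ κ s with
  | false, false => .nop
  | false, true => .push (Sy tb τ κ s)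
  | true, false => .popNone
  | true, true => .popSome (Sy tb τ κ s)

/-- The height of register `κ` before time `s` claimed by `τ` (`k + 1` bits). [folklore] -/
def hOf (κ : Fin tb.K) (s : ℕ) : ℕ := bval (fun j => τ (.h κ s j)) (tb.k + 1)

/-- The record of register `κ` at layer `ℓ`, position `p`, as a bit vector. [folklore] -/
def recAt (κ : Fin tb.K) (ℓ p : ℕ) : ℕ → Bool := fun w => R tb τ κ ℓ p w

/-- The key of a record: time bits then level bits, `2k + 1` bits. [folklore] -/
def keyOf (rec : ℕ → Bool) : ℕ := bval (fun i => rec (tb.fKey i)) (2 * tb.k + 1)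

/-- The switch setting of layer `ℓ` of the network of register `κ`. [folklore] -/
def swf (κ : Fin tb.K) (ℓ : ℕ) : ℕ → Bool := fun q => τ (.sw κ ℓ q)

/-- The time-`0` position whose record sits at layer `ℓ`, position `p`. [folklore] -/
def posBack (κ : Fin tb.K) : ℕ → ℕ → ℕ
  | 0, p => p
  | ℓ + 1, p => posBack κ ℓ (layer (tb.dim ℓ) (swf tb τ κ ℓ) p)

end Decode

/-! ### Heights -/

/-- A bit vector of zeros has value `0`. [folklore] -/
theorem bval_eq_zero {f : ℕ → Bool} : ∀ {m}, (∀ j < m, f j = false) → bval f m = 0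
  | 0, _ => rfl
  | m + 1, h => by
    show bval f m + (if f m then 2 ^ m else 0) = 0
    rw [bval_eq_zero (fun j hj => h j (Nat.lt_succ_of_lt hj)), h m (Nat.lt_succ_self m)]; rfl

/-- **The claimed heights obey the local height rules** for the recorded events.
[cite: FortnowEtAl2005, §3.1] -/
theorem heightsOK_of_tabOK (hT : TabOK tb τ) (κ : Fin tb.K) :
    HeightsOK (evOf tb τ κ) (hOf tb τ κ) tb.S := by
  refine ⟨bval_eq_zero fun j hj => hT.h0 κ j (Nat.le_of_lt_succ hj), fun s hs => ?_⟩
  have hst := hT.hstep κ s hs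
  have hc0 := hT.hc0 κ s hs
  have hcK := hT.hcK κ s hs
  simp only [evOf]
  cases h1 : T1 tb τ κ s <;> cases h0 : T0 tb τ κ s <;> simp only []
  · -- nop
    show hOf tb τ κ (s + 1) = hOf tb τ κ s
    refine bval_congr fun j hj => ?_
    have := hst j (Nat.le_of_lt_succ hj)
    simp only [HStepRel, T1, T0] at this h1 h0; rw [h1, h0] at this
    exact this
  · -- push
    show hOf tb τ κ (s + 1) = hOf tb τ κ s + 1
    have key := inc_chain (a := fun j => τ (.h κ s j)) (a' := fun j => τ (.h κ (s + 1) j))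
      (c := fun j => τ (.hc κ s j)) hc0 (tb.k + 1) (fun j hj => by
        have := hst j (Nat.le_of_lt_succ hj)
        simp only [HStepRel, T1, T0] at this h1 h0; rw [h1, h0] at this
        exact this)
    have hK : τ (.hc κ s (tb.k + 1)) = false := hcK (by simpa [T0] using h0)
    simp only [hK] at key
    simpa [hOf] using key
  · -- popNone
    show hOf tb τ κ s = 0 ∧ hOf tb τ κ (s + 1) = 0
    have hz : ∀ j < tb.k + 1, τ (.h κ s j) = false ∧ τ (.h κ (s + 1) j) = false := fun j hj => by
      have := hst j (Nat.le_of_lt_succ hj)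
      simp only [HStepRel, T1, T0] at this h1 h0; rw [h1, h0] at this
      exact this
    exact ⟨bval_eq_zero fun j hj => (hz j hj).1, bval_eq_zero fun j hj => (hz j hj).2⟩
  · -- popSome
    show hOf tb τ κ (s + 1) + 1 = hOf tb τ κ s
    have key := dec_chain (a := fun j => τ (.h κ s j)) (a' := fun j => τ (.h κ (s + 1) j))
      (b := fun j => τ (.hc κ s j)) hc0 (tb.k + 1) (fun j hj => by
        have := hst j (Nat.le_of_lt_succ hj)
        simp only [HStepRel, T1, T0] at this h1 h0; rw [h1, h0] at this
        exact this)
    have hK : τ (.hc κ s (tb.k + 1)) = false := hcK (by simpa [T0] using h0)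
    simp only [hK] at key
    simpa [hOf] using key

/-! ### Levels, times and keys of the time-`0` records -/

/-- `bval` over a concatenation of bit ranges. [folklore] -/
theorem bval_add (f : ℕ → Bool) (a : ℕ) : ∀ b, bval f (a + b) = bval f a + 2 ^ a * bval (fun j => f (a + j)) b
  | 0 => by simp [bval]
  | b + 1 => by
    show bval f (a + b) + (if f (a + b) then 2 ^ (a + b) else 0) =
      bval f a + 2 ^ a * (bval (fun j => f (a + j)) b + (if f (a + b) then 2 ^ b else 0))
    rw [bval_add f a b, Nat.pow_add]
    split_ifs <;> ring

/-- The level of a recorded event is the value of the level field. [folklore] -/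
theorem level_eq_bval (hT : TabOK tb τ) (κ : Fin tb.K) {s : ℕ} (hs : s < tb.S) :
    level (evOf tb τ κ) (hOf tb τ κ) s = bval (fun j => R tb τ κ 0 s (fLev j)) (tb.k + 1) := by
  have hl := hT.lev κ s hs
  simp only [level, evOf]
  cases h1 : T1 tb τ κ s <;> cases h0 : T0 tb τ κ s <;> simp only []
  · symm; refine bval_eq_zero fun j hj => ?_
    have := hl j (Nat.le_of_lt_succ hj); simp only [T1, T0] at h1 h0; rw [h1, h0] at this
    simpa using this
  · refine bval_congr fun j hj => ?_
    have := hl j (Nat.le_of_lt_succ hj); simp only [T1, T0] at h1 h0; rw [h1, h0] at this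
    simp at this; exact this.symm
  · symm; refine bval_eq_zero fun j hj => ?_
    have := hl j (Nat.le_of_lt_succ hj); simp only [T1, T0] at h1 h0; rw [h1, h0] at this
    simpa using this
  · refine bval_congr fun j hj => ?_
    have := hl j (Nat.le_of_lt_succ hj); simp only [T1, T0] at h1 h0; rw [h1, h0] at this
    simp at this; exact this.symm

/-- The time field of the time-`s` record has value `s`. [folklore] -/
theorem time_eq (hT : TabOK tb τ) (κ : Fin tb.K) {s : ℕ} (hs : s < tb.S) :
    bval (fun j => R tb τ κ 0 s (tb.fTim j)) tb.k = s := by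
  rw [bval_congr (g := fun j => ThreeCNF.bit j s) (fun j hj => hT.time κ s hs j hj), bval_bit]
  exact Nat.mod_eq_of_lt hs

/-- **The key of the time-`s` record is `s + 2ᵏ · level s`.** [folklore] -/
theorem keyOf_recAt_zero (hT : TabOK tb τ) (κ : Fin tb.K) {s : ℕ} (hs : s < tb.S) :
    keyOf tb (recAt tb τ κ 0 s) = s + 2 ^ tb.k * level (evOf tb τ κ) (hOf tb τ κ) s := by
  unfold keyOf
  rw [show 2 * tb.k + 1 = tb.k + (tb.k + 1) by ring, bval_add, level_eq_bval hT κ hs]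
  congr 1
  · exact (bval_congr fun j hj => by simp [recAt, TabParams.fKey, hj]).trans (time_eq hT κ hs)
  · congr 1
    exact bval_congr fun j hj => by
      simp only [recAt, TabParams.fKey, show ¬ (tb.k + j < tb.k) by omega, if_false,
        Nat.add_sub_cancel_left]

/-- Comparing keys `s + 2ᵏ a`: lexicographic by (level, time). [folklore] -/
theorem keyLt_of_key_lt {k s s' a a' : ℕ} (hs' : s' < 2 ^ k)
    (h : s + 2 ^ k * a < s' + 2 ^ k * a') : a < a' ∨ (a = a' ∧ s < s') := by
  rcases lt_trichotomy a a' with h1 | rfl | h1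
  · exact Or.inl h1
  · exact Or.inr ⟨rfl, by omega⟩
  · exfalso
    have : 2 ^ k * a' + 2 ^ k ≤ 2 ^ k * a := by
      rw [← Nat.mul_succ]; exact Nat.mul_le_mul_left _ h1
    omega

/-! ### The networks transport the records -/

/-- Dimensions of the layers are `< k`. [folklore] -/
theorem dim_lt (tb : TabParams) {ℓ : ℕ} (hℓ : ℓ < tb.L) : tb.dim ℓ < tb.k := by
  unfold TabParams.dim
  rw [List.getD_eq_getElem _ _ (by rw [length_dims]; exact hℓ)]
  exact dims_lt tb.k _ (List.getElem_mem _)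

/-- `posBack` stays below `S`. [folklore] -/
theorem posBack_lt (κ : Fin tb.K) : ∀ {ℓ p}, ℓ ≤ tb.L → p < tb.S → posBack tb τ κ ℓ p < tb.S
  | 0, p, _, hp => hp
  | ℓ + 1, p, hℓ, hp => by
    show posBack tb τ κ ℓ (layer (tb.dim ℓ) (swf tb τ κ ℓ) p) < tb.S
    exact posBack_lt κ (Nat.le_of_succ_le hℓ) (layer_lt (dim_lt tb hℓ) hp _)

/-- `posBack` is injective. [folklore] -/
theorem posBack_injective (κ : Fin tb.K) : ∀ ℓ, Function.Injective (posBack tb τ κ ℓ)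
  | 0 => fun p q h => h
  | ℓ + 1 => fun p q h => by
    have h' := posBack_injective κ ℓ h
    have := congr_arg (layer (tb.dim ℓ) (swf tb τ κ ℓ)) h'
    rwa [layer_layer, layer_layer] at this

/-- `posBack` is onto `[0, S)`. [folklore] -/
theorem exists_posBack_eq (κ : Fin tb.K) {ℓ : ℕ} (hℓ : ℓ ≤ tb.L) {q : ℕ} (hq : q < tb.S) :
    ∃ p < tb.S, posBack tb τ κ ℓ p = q := by
  classical
  have h := Finset.surj_on_of_inj_on_of_card_le (s := Finset.range tb.S)
    (t := Finset.range tb.S) (fun p _ => posBack tb τ κ ℓ p)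
    (fun p hp => Finset.mem_range.2 (posBack_lt κ hℓ (Finset.mem_range.1 hp)))
    (fun p₁ p₂ _ _ h => posBack_injective κ ℓ h) le_rfl q (Finset.mem_range.2 hq)
  obtain ⟨p, hp, hpq⟩ := h
  exact ⟨p, Finset.mem_range.1 hp, hpq.symm⟩

/-- **Record transport**: the record at layer `ℓ ≤ L`, position `p < S`, is the time-`0`
record of position `posBack ℓ p` (all `W` bits). [folklore] -/
theorem rec_transport (hT : TabOK tb τ) (κ : Fin tb.K) :
    ∀ {ℓ p}, ℓ ≤ tb.L → p < tb.S → ∀ w < tb.W,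
      recAt tb τ κ ℓ p w = recAt tb τ κ 0 (posBack tb τ κ ℓ p) w
  | 0, p, _, _, w, _ => rfl
  | ℓ + 1, p, hℓ, hp, w, hw => by
    have hℓ' : ℓ < tb.L := Nat.lt_of_succ_le hℓ
    have hnet := hT.net κ ℓ hℓ' p hp w hw
    show R tb τ κ (ℓ + 1) p w = recAt tb τ κ 0 (posBack tb τ κ ℓ (layer (tb.dim ℓ) (swf tb τ κ ℓ) p)) w
    rw [hnet, ← rec_transport hT κ (Nat.le_of_succ_le hℓ) (layer_lt (dim_lt tb hℓ') hp _) w hw]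
    simp only [recAt, layer, swf]
    split_ifs <;> rfl

/-! ### The sorted certificate -/

/-- Field indices are below the record width. [folklore] -/
theorem fKey_lt (tb : TabParams) {i : ℕ} (hi : i < 2 * tb.k + 1) : tb.fKey i < tb.W := by
  unfold TabParams.fKey TabParams.fTim fLev TabParams.W; split_ifs <;> omega

/-- `fLev_lt` (auxiliary). [folklore] -/
theorem fLev_lt (tb : TabParams) {j : ℕ} (hj : j ≤ tb.k) : fLev j < tb.W := by
  unfold fLev TabParams.W; omega

/-- `fT1_lt` (auxiliary). [folklore] -/
theorem fT1_lt (tb : TabParams) : fT1 < tb.W := by unfold fT1 TabParams.W; omega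
/-- `fT0_lt` (auxiliary). [folklore] -/
theorem fT0_lt (tb : TabParams) : fT0 < tb.W := by unfold fT0 TabParams.W; omega
/-- `fSym_lt` (auxiliary). [folklore] -/
theorem fSym_lt (tb : TabParams) : fSym < tb.W := by unfold fSym TabParams.W; omega

/-- **The output layer is a sorted certificate** for the recorded events and claimed heights
of every register, along `π = posBack L`. [cite: FortnowEtAl2005, §3.1] -/
theorem cert_of_tabOK (hT : TabOK tb τ) (κ : Fin tb.K) :
    Cert (evOf tb τ κ) (hOf tb τ κ) tb.S (posBack tb τ κ tb.L) := by
  have hL : tb.L ≤ tb.L := le_rfl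
  -- keys at the output layer
  have hkey : ∀ {p}, p < tb.S → keyOf tb (recAt tb τ κ tb.L p) =
      posBack tb τ κ tb.L p + 2 ^ tb.k * level (evOf tb τ κ) (hOf tb τ κ) (posBack tb τ κ tb.L p) := by
    intro p hp
    rw [← keyOf_recAt_zero hT κ (posBack_lt κ hL hp)]
    exact bval_congr fun i hi => rec_transport hT κ hL hp _ (fKey_lt tb hi)
  -- type and symbol bits at the output layer are those at time 0
  have hbit : ∀ {p} (hp : p < tb.S) {w} (hw : w < tb.W),
      R tb τ κ tb.L p w = R tb τ κ 0 (posBack tb τ κ tb.L p) w := fun hp w hw =>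
    rec_transport hT κ hL hp w hw
  refine ⟨fun p hp => posBack_lt κ hL hp, fun s hs => exists_posBack_eq κ hL hs,
    fun p hp => ?_, fun p hp b hev => ?_, fun hS b hev => ?_⟩
  · -- sorted: the comparison chain
    have hlt := lt_chain (a := fun i => R tb τ κ tb.L p (tb.fKey i))
      (b := fun i => R tb τ κ tb.L (p + 1) (tb.fKey i)) (l := fun i => τ (.lt κ p i))
      (hT.lt0 κ p hp) (2 * tb.k + 1) (fun i hi => hT.ltStep κ p hp i hi)
    have h1 : keyOf tb (recAt tb τ κ tb.L p) < keyOf tb (recAt tb τ κ tb.L (p + 1)) :=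
      hlt.1 (hT.ltF κ p hp)
    rw [hkey (Nat.lt_of_succ_lt hp), hkey hp] at h1
    exact keyLt_of_key_lt (posBack_lt κ hL hp) h1
  · -- adjacency
    have hp' : p < tb.S := Nat.lt_of_succ_lt hp
    have htt : T1 tb τ κ (posBack tb τ κ tb.L (p + 1)) = true ∧
        T0 tb τ κ (posBack tb τ κ tb.L (p + 1)) = true ∧ Sy tb τ κ (posBack tb τ κ tb.L (p + 1)) = b := by
      revert hev; simp only [evOf]
      cases T1 tb τ κ _ <;> cases T0 tb τ κ _ <;> simp
    obtain ⟨h1, h0, hsy⟩ := htt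
    have h1' : R tb τ κ tb.L (p + 1) fT1 = true := by rw [hbit hp (fT1_lt tb)]; exact h1
    have h0' : R tb τ κ tb.L (p + 1) fT0 = true := by rw [hbit hp (fT0_lt tb)]; exact h0
    obtain ⟨hq1, hq0, hae⟩ := hT.adj1 κ p hp h1' h0'
    have hsym := hT.adj2 κ p hp h1' h0'
    rw [hbit hp' (fT1_lt tb)] at hq1
    rw [hbit hp' (fT0_lt tb)] at hq0
    rw [hbit hp' (fSym_lt tb), hbit hp (fSym_lt tb)] at hsym
    -- level bits agree
    have hlev := (eq_chain (a := fun j => R tb τ κ tb.L p (fLev j))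
      (b := fun j => R tb τ κ tb.L (p + 1) (fLev j)) (e := fun j => τ (.ae κ p j))
      (hT.ae0 κ p hp) (tb.k + 1) (fun j hj => hT.aeStep κ p hp j (Nat.le_of_lt_succ hj))).1 hae
    refine ⟨?_, ?_⟩
    · show evOf tb τ κ (posBack tb τ κ tb.L p) = Ev.push b
      have : Sy tb τ κ (posBack tb τ κ tb.L p) = b := by rw [← hsy]; exact hsym
      simp only [evOf]
      rw [show T1 tb τ κ (posBack tb τ κ tb.L p) = false from hq1,
        show T0 tb τ κ (posBack tb τ κ tb.L p) = true from hq0]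
      simp only [this]
    · rw [level_eq_bval hT κ (posBack_lt κ hL hp'), level_eq_bval hT κ (posBack_lt κ hL hp)]
      refine bval_congr fun j hj => ?_
      have := hlev j hj
      rw [hbit hp' (fLev_lt tb (Nat.le_of_lt_succ hj)), hbit hp (fLev_lt tb (Nat.le_of_lt_succ hj))] at this
      exact this
  · -- first
    apply hT.first κ
    have htt : T1 tb τ κ (posBack tb τ κ tb.L 0) = true ∧ T0 tb τ κ (posBack tb τ κ tb.L 0) = true := by
      revert hev; simp only [evOf]
      cases T1 tb τ κ _ <;> cases T0 tb τ κ _ <;> simp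
    rw [hbit hS (fT1_lt tb), hbit hS (fT0_lt tb)]
    exact htt

/-- **Every register transcript is consistent**, and the claimed heights are the true ones.
[cite: FortnowEtAl2005, §3.1] -/
theorem consistent_of_tabOK (hT : TabOK tb τ) (κ : Fin tb.K) : Consistent (evOf tb τ κ) tb.S :=
  (consistent_of_cert (heightsOK_of_tabOK hT κ) (cert_of_tabOK hT κ)).1

/-! ### The machine phase: one-hot program counters -/

/-- There is an active address `≤ |P|` at every machine time. [folklore] -/
theorem exists_active (hT : TabOK tb τ) : ∀ s, tb.I ≤ s → s ≤ tb.Send →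
    ∃ q, q ≤ tb.np ∧ τ (.u s q) = true := by
  intro s hIs hsS
  obtain ⟨d, rfl⟩ := Nat.exists_eq_add_of_le hIs
  induction d with
  | zero => exact ⟨0, Nat.zero_le _, hT.u0⟩
  | succ d ih =>
    obtain ⟨q, hq, hu⟩ := ih (Nat.le_add_right _ _) (by omega)
    have h := hT.tr (tb.I + d) (Nat.le_add_right _ _) (by omega) q hq hu
    exact ⟨_, h.1, by rw [Nat.add_succ]; exact h.2⟩

open Classical in
/-- The program counter at machine time `s`: the active address. [folklore] -/
noncomputable def pcAt (hT : TabOK tb τ) (s : ℕ) : ℕ :=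
  if h : tb.I ≤ s ∧ s ≤ tb.Send then Nat.find (exists_active hT s h.1 h.2) else 0

/-- `pcAt_spec` (auxiliary). [folklore] -/
theorem pcAt_spec (hT : TabOK tb τ) {s : ℕ} (h1 : tb.I ≤ s) (h2 : s ≤ tb.Send) :
    pcAt hT s ≤ tb.np ∧ τ (.u s (pcAt hT s)) = true := by
  classical
  unfold pcAt; rw [dif_pos ⟨h1, h2⟩]; exact Nat.find_spec (exists_active hT s h1 h2)

/-- The active address is unique. [folklore] -/
theorem eq_pcAt (hT : TabOK tb τ) {s : ℕ} (h1 : tb.I ≤ s) (h2 : s ≤ tb.Send) {q : ℕ}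
    (hq : q ≤ tb.np) (hu : τ (.u s q) = true) : q = pcAt hT s := by
  obtain ⟨hp, hup⟩ := pcAt_spec hT h1 h2
  by_contra hne
  rcases lt_or_gt_of_ne hne with hlt | hlt
  · exact hT.u2 s h1 h2 _ _ hlt hp ⟨hu, hup⟩
  · exact hT.u2 s h1 h2 _ _ hlt hq ⟨hup, hu⟩

/-- The machine starts at `0` and has halted at the final check. [folklore] -/
theorem pcAt_I (hT : TabOK tb τ) : pcAt hT tb.I = 0 :=
  (eq_pcAt hT le_rfl (Nat.le_add_right _ _) (Nat.zero_le _) hT.u0).symm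

/-- `pcAt_Send` (auxiliary). [folklore] -/
theorem pcAt_Send (hT : TabOK tb τ) : pcAt hT tb.Send = tb.np :=
  (eq_pcAt hT (Nat.le_add_right _ _) le_rfl le_rfl hT.acc).symm

/-- The popped claim at machine time `s`. [folklore] -/
noncomputable def oAt (hT : TabOK tb τ) (s : ℕ) : Option Bool := oClaim tb τ (pcAt hT s) s

/-- The control rule holds along the active addresses. [folklore] -/
theorem controlStep_pcAt (hT : TabOK tb τ) {s : ℕ} (h1 : tb.I ≤ s) (h2 : s < tb.Send) :
    ControlStep tb.P (pcAt hT s) (oAt hT s) (pcAt hT (s + 1)) := by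
  obtain ⟨hp, hup⟩ := pcAt_spec hT h1 h2.le
  obtain ⟨htgt, hu'⟩ := hT.tr s h1 h2 _ hp hup
  have heq := eq_pcAt hT (Nat.le_succ_of_le h1) (Nat.succ_le_of_lt h2) htgt hu'
  unfold ControlStep
  unfold target at heq
  unfold oAt
  rcases hP : tb.P[pcAt hT s]? with _ | ⟨k, a⟩ | ⟨k, j⟩ | ⟨j⟩ <;> rw [hP] at heq <;> exact heq.symm

/-- The recorded events of the machine phase are the register events of the transcript.
[folklore] -/
theorem regEv_eq_evOf (hT : TabOK tb τ) (κ : Fin tb.K) {s : ℕ} (h1 : tb.I ≤ s) (h2 : s < tb.Send) :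
    regEv tb.P κ (pcAt hT s) (oAt hT s) = evOf tb τ κ s := by
  obtain ⟨hp, hup⟩ := pcAt_spec hT h1 h2.le
  have hM := hT.recM κ s h1 h2 _ hp hup
  unfold MSpec at hM
  unfold regEv oAt oClaim evOf
  rcases hP : tb.P[pcAt hT s]? with _ | ⟨k, a⟩ | ⟨k, j⟩ | ⟨j⟩ <;> rw [hP] at hM <;> simp only at hM ⊢
  · simp only [T1, T0]; rw [hM.1, hM.2]
  · by_cases hk : k = κ
    · subst hk; rw [if_pos rfl] at hM ⊢; simp only [T1, T0, Sy]; rw [hM.1, hM.2.1, hM.2.2]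
    · rw [if_neg hk] at hM ⊢; simp only [T1, T0]; rw [hM.1, hM.2]
  · by_cases hk : k = κ
    · subst hk; rw [if_pos rfl] at hM ⊢; simp only [T1, T0, Sy]; rw [hM]
      cases R tb τ k 0 s fT0 <;> rfl
    · rw [if_neg hk] at hM ⊢; simp only [T1, T0]; rw [hM.1, hM.2]
  · simp only [T1, T0]; rw [hM.1, hM.2]

/-- **The replayed stacks follow the program** through the machine phase.
[cite: Cook1971, Thm. 1] -/
theorem iterate_eq_st (hT : TabOK tb τ) (hfit : tb.Send < tb.S) :
    (tb.P.step^[tb.T]) ⟨pcAt hT tb.I, fun κ => st (evOf tb τ κ) tb.I⟩ =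
      ⟨pcAt hT tb.Send, fun κ => st (evOf tb τ κ) tb.Send⟩ := by
  have h := iterate_eq_of_transcript tb.P (pcAt hT) (oAt hT) (fun s κ => st (evOf tb τ κ) s) tb.I tb.T
    (fun s h1 h2 κ => by rw [regEv_eq_evOf hT κ h1 h2]; rfl)
    (fun s h1 h2 κ hev => by
      rw [regEv_eq_evOf hT κ h1 h2] at hev
      exact (consistent_of_tabOK hT κ s (lt_trans h2 hfit)).1 hev)
    (fun s h1 h2 κ b hev => by
      rw [regEv_eq_evOf hT κ h1 h2] at hev
      exact (consistent_of_tabOK hT κ s (lt_trans h2 hfit)).2 b hev)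
    (fun s h1 h2 => controlStep_pcAt hT h1 h2) tb.T le_rfl
  exact h

/-! ### The virtual input phase loads `⟨x, y⟩` -/

section Virtual

variable (tb)

/-- The witness spelled by presence bits `pr` and values `vl`: the values of the present slots,
in slot order. [folklore] -/
def ysOf (pr vl : ℕ → Bool) : List Bool := ((List.range tb.Y).filter pr).map vl

/-- The witness has at most `Y` symbols. [folklore] -/
theorem length_ysOf_le (pr vl : ℕ → Bool) : (ysOf tb pr vl).length ≤ tb.Y := by
  unfold ysOf
  rw [List.length_map]
  exact (List.length_filter_le _ _).trans (by rw [List.length_range])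

/-- With the presence bits of a prefix of length `|y| ≤ Y` and the values of `y`, the witness is
`y`. [folklore] -/
theorem ysOf_prefix {y : List Bool} (hy : y.length ≤ tb.Y) :
    ysOf tb (fun j => decide (j < y.length)) (fun j => y.getD j false) = y := by
  unfold ysOf
  have h1 : ∀ j ∈ List.range y.length, decide (j < y.length) = true := fun j hj => by
    simpa using List.mem_range.1 hj
  have h2 : ∀ j ∈ (List.range (tb.Y - y.length)).map (y.length + ·), ¬ (decide (j < y.length) = true) := by
    intro j hj
    simp only [List.mem_map, List.mem_range] at hj
    obtain ⟨a, -, rfl⟩ := hj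
    simp
  have hf : (List.range tb.Y).filter (fun j => decide (j < y.length)) = List.range y.length := by
    conv_lhs => rw [show tb.Y = y.length + (tb.Y - y.length) by omega, List.range_add]
    rw [List.filter_append, List.filter_eq_self.2 h1, List.filter_eq_nil_iff.2 h2, List.append_nil]
  rw [hf]
  apply List.ext_getElem?
  intro i
  rw [List.getElem?_map]
  by_cases hi : i < y.length
  · rw [List.getElem?_eq_getElem (by simpa using hi), List.getElem_range, Option.map_some,
      List.getD_eq_getElem?_getD, List.getElem?_eq_getElem hi]; rfl
  · rw [List.getElem?_eq_none (by simp; omega), Option.map_none,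
      List.getElem?_eq_none (Nat.le_of_not_lt hi)]

/-- The symbols pushed in the second virtual phase, from a source valuation `xv`. [folklore] -/
def v2list (xv : ℕ → Bool) : List Bool :=
  (List.range (2 * tb.n + 2)).map fun r => Sum.elim id xv (v2src tb.n r)

variable {tb}
variable (ev : Fin tb.K → ℕ → Ev) (pr vl xv : ℕ → Bool)

/-- Hypotheses on an event family: the schedule of the virtual input phase. [folklore] -/
structure VirtualPhase : Prop where
  /-- phase 1 on `inp`: push the present slots, bottom up -/
  v1 : ∀ s < tb.Y, ev tb.inp s = (if pr (tb.Y - 1 - s) then Ev.push (vl (tb.Y - 1 - s)) else Ev.nop)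
  /-- phase 2 on `inp`: push the doubled input -/
  v2 : ∀ r < 2 * tb.n + 2, ev tb.inp (tb.Y + r) = Ev.push (Sum.elim id xv (v2src tb.n r))
  /-- other registers idle -/
  other : ∀ κ ≠ tb.inp, ∀ s < tb.I, ev κ s = Ev.nop

variable {ev pr vl xv}

/-- Registers other than `inp` stay empty through the virtual input phase. [folklore] -/
theorem VirtualPhase.st_other (hV : VirtualPhase ev pr vl xv) {κ : Fin tb.K} (hκ : κ ≠ tb.inp) :
    ∀ s ≤ tb.I, st (ev κ) s = []
  | 0, _ => rfl
  | s + 1, hs => by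
    have hs' : s < tb.I := Nat.lt_of_succ_le hs
    show upd (ev κ s) (st (ev κ) s) = []
    rw [VirtualPhase.st_other hV hκ s hs'.le, hV.other κ hκ s hs']; rfl

/-- After `s ≤ Y` steps of the first virtual phase, `inp` holds the present slots among the
last `s`, in slot order. [folklore] -/
theorem VirtualPhase.st_inp_V1 (hV : VirtualPhase ev pr vl xv) : ∀ s ≤ tb.Y, st (ev tb.inp) s =
    ((List.range' (tb.Y - s) s).filter pr).map vl
  | 0, _ => by simp [st]
  | s + 1, hs => by
    have hs' : s < tb.Y := Nat.lt_of_succ_le hs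
    show upd (ev tb.inp s) (st (ev tb.inp) s) = _
    rw [VirtualPhase.st_inp_V1 hV s hs'.le, show tb.Y - s = (tb.Y - (s + 1)) + 1 by omega,
      List.range'_succ, List.filter_cons, hV.v1 s hs', show tb.Y - 1 - s = tb.Y - (s + 1) by omega]
    cases pr (tb.Y - (s + 1)) <;> simp [upd]

/-- After the first virtual phase `inp` holds the witness. [folklore] -/
theorem VirtualPhase.st_inp_Y (hV : VirtualPhase ev pr vl xv) : st (ev tb.inp) tb.Y = ysOf tb pr vl := by
  rw [hV.st_inp_V1 tb.Y le_rfl, Nat.sub_self, ysOf, List.range_eq_range']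

/-- After `r` steps of the second virtual phase. [folklore] -/
theorem VirtualPhase.st_inp_V2 (hV : VirtualPhase ev pr vl xv) : ∀ r ≤ 2 * tb.n + 2,
    st (ev tb.inp) (tb.Y + r) = ((v2list tb xv).take r).reverse ++ ysOf tb pr vl
  | 0, _ => by simpa using hV.st_inp_Y
  | r + 1, hr => by
    have hr' : r < 2 * tb.n + 2 := Nat.lt_of_succ_le hr
    show upd (ev tb.inp (tb.Y + r)) (st (ev tb.inp) (tb.Y + r)) = _
    rw [VirtualPhase.st_inp_V2 hV r hr'.le, hV.v2 r hr']
    have hlen : r < (v2list tb xv).length := by simp [v2list]; exact hr'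
    rw [List.take_succ_eq_append_getElem hlen, List.reverse_append]
    simp only [upd, List.reverse_cons, List.reverse_nil, List.nil_append, List.cons_append]
    congr 1
    simp [v2list]

/-- Doubling commutes with reversal (local copy of `reverse_flatMap_dbl`, `StackLists.lean`).
[folklore] -/
private theorem reverse_flatMap_dbl' (a : List Bool) :
    (a.flatMap fun b => [b, b]).reverse = a.reverse.flatMap fun b => [b, b] := by
  induction a with
  | nil => rfl
  | cons b a ih => simp [List.flatMap_cons, ih]

/-- Indexing a doubled list. [folklore] -/
theorem getElem?_flatMap_dbl (l : List Bool) : ∀ i, (l.flatMap fun b => [b, b])[i]? = l[i / 2]? := by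
  induction l with
  | nil => intro i; simp
  | cons b l ih =>
    intro i
    rw [List.flatMap_cons]
    match i with
    | 0 => rfl
    | 1 => rfl
    | i + 2 =>
      show (l.flatMap fun b => [b, b])[i]? = (b :: l)[(i + 2) / 2]?
      rw [ih, show (i + 2) / 2 = i / 2 + 1 by omega]; rfl

/-- **The second virtual phase pushes the doubled input**: read bottom-up, the pushed symbols
spell `(x.flatMap [b, b]) ++ [false, true]`. [folklore] -/
theorem reverse_v2list {x : List Bool} (hxn : x.length = tb.n) {xv : ℕ → Bool}
    (hx : ∀ j < tb.n, xv j = x.getD j false) :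
    (v2list tb xv).reverse = (x.flatMap fun b => [b, b]) ++ [false, true] := by
  rw [← List.reverse_inj, List.reverse_reverse, List.reverse_append, reverse_flatMap_dbl']
  apply List.ext_getElem?
  intro r
  by_cases hr : r < 2 * tb.n + 2
  · have hl : (v2list tb xv)[r]? = some (Sum.elim id xv (v2src tb.n r)) := by
      simp [v2list, hr]
    rw [hl]
    rcases Nat.lt_or_ge r 2 with hr2 | hr2
    · interval_cases r <;> simp [v2src]
    · have hi : r - 2 < (x.reverse.flatMap fun b => [b, b]).length := by
        simp [List.length_flatMap, hxn]; omega
      rw [List.getElem?_append_right (by simp; omega), show ([false, true] : List Bool).reverse.length = 2 by rfl,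
        getElem?_flatMap_dbl, List.getElem?_reverse (by rw [hxn]; omega)]
      have hj : tb.n - 1 - (r - 2) / 2 < tb.n := by omega
      simp only [v2src, show r ≠ 0 by omega, show r ≠ 1 by omega, if_false, Sum.elim_inr, hx _ hj,
        hxn]
      rw [List.getD_eq_getElem?_getD, List.getElem?_eq_getElem (by rw [hxn]; omega)]
      simp only [Option.getD_some]
  · rw [List.getElem?_eq_none (by simp [v2list]; omega),
      List.getElem?_eq_none (by simp [List.length_flatMap, hxn]; omega)]

/-- **The virtual input phase loads `boolPair x y`** on `inp` and nothing else. [folklore] -/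
theorem VirtualPhase.st_I (hV : VirtualPhase ev pr vl xv) {x : List Bool} (hxn : x.length = tb.n)
    (hx : ∀ j < tb.n, xv j = x.getD j false) :
    (fun κ => st (ev κ) tb.I) = AStore.single tb.inp (boolPair x (ysOf tb pr vl)) := by
  funext κ
  by_cases hκ : κ = tb.inp
  · subst hκ
    rw [AStore.single_self]
    show st (ev tb.inp) (tb.Y + (2 * tb.n + 2)) = _
    rw [hV.st_inp_V2 _ le_rfl, List.take_of_length_le (by simp [v2list]),
      reverse_v2list hxn hx, boolPair, List.append_assoc]
  · rw [AStore.single_of_ne hκ]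
    exact hV.st_other hκ _ le_rfl

end Virtual

/-- The recorded events follow the virtual-phase schedule. [folklore] -/
theorem virtualPhase_evOf (hT : TabOK tb τ) (hfit : tb.Send < tb.S) :
    VirtualPhase (evOf tb τ) (fun j => τ (.yp j)) (fun j => τ (.yv j)) (fun j => τ (.x j)) := by
  have hIS : tb.I ≤ tb.S := (Nat.le_add_right _ _).trans hfit.le
  refine ⟨fun s hs => ?_, fun r hr => ?_, fun κ hκ s hs => ?_⟩
  · obtain ⟨h1, h0, hsy⟩ := hT.recV1 s hs
    simp only [evOf, T1, T0, Sy, h1, h0, hsy]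
    cases τ (.yp (tb.Y - 1 - s)) <;> rfl
  · obtain ⟨h1, h0, hsy⟩ := hT.recV2 r hr
    simp only [evOf, T1, T0, Sy, h1, h0, hsy]
    congr 1
    cases v2src tb.n r <;> rfl
  · have hnop := hT.recNop κ s (lt_of_lt_of_le hs hIS) (Or.inl ⟨hs, hκ⟩)
    simp only [evOf, T1, T0, hnop.1, hnop.2]

/-! ### Soundness -/

/-- **Soundness of the tableau constraints.** If `τ` satisfies `TabOK` and its input-copy
variables spell `x`, then with the witness `y = ysOf τ` (`|y| ≤ Y`) the program, started at
address `0` with `boolPair x y` on `inp`, is after `T` steps at the halting address `|P|` with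
`true` on top of `out`. [cite: FortnowEtAl2005, §3.1] -/
theorem tabOK_sound (hT : TabOK tb τ) (hfit : tb.Send < tb.S) {x : List Bool} (hxn : x.length = tb.n)
    (hx : ∀ j < tb.n, τ (.x j) = x.getD j false) :
    ∃ y : List Bool, y.length ≤ tb.Y ∧ ∃ Rf : AStore Bool (Fin tb.K),
      (tb.P.step^[tb.T]) ⟨0, AStore.single tb.inp (boolPair x y)⟩ = ⟨tb.np, Rf⟩ ∧
        (Rf tb.out).head? = some true := by
  refine ⟨ysOf tb (fun j => τ (.yp j)) (fun j => τ (.yv j)), length_ysOf_le tb _ _,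
    fun κ => st (evOf tb τ κ) tb.Send, ?_, ?_⟩
  · have h := iterate_eq_st hT hfit
    rwa [pcAt_I hT, pcAt_Send hT, (virtualPhase_evOf hT hfit).st_I hxn hx] at h
  · obtain ⟨h1, h0, hsy⟩ := hT.recF
    have hev : evOf tb τ tb.out tb.Send = .popSome true := by
      simp only [evOf, T1, T0, Sy, h1, h0, hsy]
    exact (consistent_of_tabOK hT tb.out tb.Send hfit).2 true hev

end Tableau

end Literature.Computability.Complexity
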